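import Summits.CriticalPhenomena.Ising3DConformalLimit.Theorems.LogPolarProxyProxyUniversalityDefs
import Summits.CriticalPhenomena.Ising3DConformalLimit.Theorems.ConformalPoissonDeviceDeviceWeylUniversalityStubLimitZero
import Literature.Probability.LatticeModels.CriticalCorrWellDefined
import HarnessLib

/-!
# Crux `ProxyUniversality` (stmt-CriticalPhenomena-11288), line `registered` — stubs Z `stub_proxySliceZero`
# and O `stub_proxySliceOdd`: the order-`0` and odd-order slices of the proxy convergence hold for EVERY profile

Route `LogPolarProxy`, sub-problem `Ising3DConformalLimit`; skeleton `Cruxes/ProxyUniversality/Lines/birth.lean`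
(v2, lead `prover-line-stmt-CriticalPhenomena-11288-0`). The v2 skeleton reshapes the planner's one-gauge stub
S1 into S1' (even orders `n ≠ 0`, OPEN) plus the two universal slices proved here:

* **Z** `stub_proxySliceZero`: for every coupling profile `J_r, J_θ, J_φ`, amplitude `A`, renormalisation `ρ`
  and every pointwise scaling limit `S` of `criticalCorr 3` (renormalised by `ρ`), the order-`0` renormalised
  proxy correlator converges to `S 0` locally uniformly on `offAxis 0`. Both sides are the constant `1`:
  `proxyCorr_zero` (Defs module: empty weight, empty monomial) and `S 0 ≡ 1`
  (`DeviceWeylUniversality.stub_limitZero`: `⟨1⟩⁺_{β_c} = 1`).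
* **O** `stub_proxySliceOdd`: for odd `n` the renormalised proxy correlator is identically `0`
  (`proxyCorr_eq_zero_of_odd`, the global spin flip of the free-b.c. proxy) and `S n = 0` on
  `NonCoincident 3 n ⊇ offAxis n`, because the odd critical correlators of `ℤ³` vanish: `m*(β_c) = 0`
  (Aizenman–Duminil-Copin–Sidoravicius 2015, tree theorem `spontaneousMagnetization_criticalBeta_eq_zero_holds`)
  makes the plus state even (`plusCorr_eq_zero_of_odd_card`), and limits along `𝓝[>] 0` are unique. The
  `d = 3` odd-vanishing lemma is re-derived here from `CriticalCorrWellDefined` (already in the cone of the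
  landed S3 file) rather than imported from `CriticalUrsellFourSign` (heavier cone).

Both are instances of one topological triviality, `tendstoLocallyUniformlyOn_of_forall_eq`: a sequence of
functions constant on `s` converges locally uniformly on `s` to any function with the same constant value on `s`.

References: M. Aizenman, H. Duminil-Copin, V. Sidoravicius, Comm. Math. Phys. 334 (2015), Thm. 1.2
[AizenmanDuminilCopinSidoraviciusCMP2015]; S. Friedli, Y. Velenik (CUP 2017) §3.7.1, eq. (3.33)
[FriedliVelenik2017]. No definitions are introduced.
-/

noncomputable section

namespace Summit.CriticalPhenomena.Ising3DConformalLimit.Cruxes.ProxyUniversality.Birth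

open scoped BigOperators Topology
open Filter Set Function
open Literature.Probability.LatticeModels
open Summit.CriticalPhenomena.Ising3DConformalLimit.Theorems.DeviceWeylUniversality (stub_limitZero)

/-! ### One topological triviality -/

/-- A family of functions each equal to the constant `c` on `s` converges locally uniformly on `s` to any
function equal to `c` on `s` (along any filter). [folklore] -/
theorem tendstoLocallyUniformlyOn_of_forall_eq {α β ι : Type*} [TopologicalSpace α] [UniformSpace β]
    {F : ι → α → β} {f : α → β} {p : Filter ι} {s : Set α} {c : β}
    (hF : ∀ n, ∀ y ∈ s, F n y = c) (hf : ∀ y ∈ s, f y = c) : TendstoLocallyUniformlyOn F f p s := by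
  intro u hu x _
  refine ⟨s, self_mem_nhdsWithin, Filter.Eventually.of_forall fun n y hy => ?_⟩
  rw [hf y hy, hF n y hy]
  exact refl_mem_uniformity hu

/-! ### The odd critical correlators of `ℤ³` vanish (light re-derivation at `d = 3`) -/

/-- Spin monomials with an odd number of factors are odd spin products: `∏ᵢ σ_{yᵢ} = σ_A` with `|A|` odd
(parity read off at the all-minus configuration). [cite: FriedliVelenik2017, §3.6.1] -/
theorem slices_exists_spinMonomial_eq_spinProduct_odd {n : ℕ} (hn : Odd n) (y : Fin n → Site 3) :
    ∃ A : Finset (Site 3), Odd A.card ∧ spinMonomial y = spinProduct A := by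
  -- adapted from Literature/Probability/LatticeModels/CriticalUrsellFourSign.lean
  classical
  obtain ⟨A, hA⟩ := exists_spinMonomial_eq_spinProduct y
  refine ⟨A, ?_, hA⟩
  have h := congrFun hA (fun _ => -1)
  simp only [spinMonomial, spinProduct, spinAt] at h
  have hl : (∏ _i : Fin n, ((((-1 : ℤˣ)) : ℤ) : ℝ)) = (-1) ^ n := by simp
  have hr : (∏ _v ∈ A, ((((-1 : ℤˣ)) : ℤ) : ℝ)) = (-1) ^ A.card := by simp
  rw [hl, hr, hn.neg_one_pow] at h
  by_contra hev
  rw [Nat.not_odd_iff_even] at hev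
  rw [hev.neg_one_pow] at h
  norm_num at h

/-- **Odd critical correlators of `ℤ³` vanish**: `⟨∏ᵢ σ_{yᵢ}⟩⁺_{β_c} = 0` for odd `n`, by `m*(β_c) = 0`
(Aizenman–Duminil-Copin–Sidoravicius 2015, tree theorem `spontaneousMagnetization_criticalBeta_eq_zero_holds`)
and evenness of the plus state when `m* = 0` (`plusCorr_eq_zero_of_odd_card`).
[cite: AizenmanDuminilCopinSidoraviciusCMP2015, Thm. 1.2 with Cor. 1.5 (1)] -/
theorem criticalCorr_three_eq_zero_of_odd {n : ℕ} (hn : Odd n) (y : Fin n → Site 3) :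
    criticalCorr 3 n y = 0 := by
  -- adapted from Literature/Probability/LatticeModels/CriticalUrsellFourSign.lean (criticalCorr_eq_zero_of_odd)
  classical
  obtain ⟨A, hA, hyA⟩ := slices_exists_spinMonomial_eq_spinProduct_odd hn y
  have h : criticalCorr 3 n y = plusCorr 3 (criticalBeta 3) 0 A := by
    show plusExpect 3 (criticalBeta 3) 0 (spinMonomial y) = _
    rw [hyA]
    rfl
  rw [h]
  exact plusCorr_eq_zero_of_odd_card (criticalBeta_nonneg 3)
    (spontaneousMagnetization_criticalBeta_eq_zero_holds (d := 3) (by norm_num)) hA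

/-! ### The two registered slice stubs -/

/-- **Z `stub_proxySliceZero` — the order-`0` slice holds for every profile**: the `n = 0` renormalised
proxy correlator is identically `1` (`proxyCorr_zero`) and so is the order-`0` pointwise limit `S 0` of
`criticalCorr 3` (`stub_limitZero`), hence locally uniform convergence on `offAxis 0`. -/
theorem stub_proxySliceZero :
    ∀ (Jr Jt Jp : ℕ → ℕ → ℝ) (A : ℕ → ℝ → ℝ) (ρ : ℝ → ℝ) (S : CorrFamily 3),
      HasPointwiseScalingLimit (criticalCorr 3) ρ S →
      TendstoLocallyUniformlyOn (fun N : ℕ => proxyCorr Jr Jt Jp A ρ N 0) (S 0) atTop (offAxis 0) := by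
  intro Jr Jt Jp A ρ S hlim
  exact tendstoLocallyUniformlyOn_of_forall_eq (c := (1 : ℝ))
    (fun N y _ => proxyCorr_zero Jr Jt Jp A ρ N y) (fun y _ => stub_limitZero ρ S hlim y)

/-- **O `stub_proxySliceOdd` — the odd-order slices hold for every profile**: for odd `n` the renormalised
proxy correlator is identically `0` (global spin flip, `proxyCorr_eq_zero_of_odd`) and every pointwise limit
`S n` of `criticalCorr 3` vanishes on `NonCoincident 3 n ⊇ offAxis n` (odd critical correlators vanish,
`criticalCorr_three_eq_zero_of_odd`, and limits along `𝓝[>] 0` are unique). -/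
theorem stub_proxySliceOdd :
    ∀ (Jr Jt Jp : ℕ → ℕ → ℝ) (A : ℕ → ℝ → ℝ) (ρ : ℝ → ℝ) (S : CorrFamily 3),
      HasPointwiseScalingLimit (criticalCorr 3) ρ S → ∀ n : ℕ, Odd n →
      TendstoLocallyUniformlyOn (fun N : ℕ => proxyCorr Jr Jt Jp A ρ N n) (S n) atTop (offAxis n) := by
  intro Jr Jt Jp A ρ S hlim n hn
  -- `S n = 0` on `NonCoincident 3 n`: the rescaled odd correlators are identically `0` and limits along
  -- `𝓝[>] 0` are unique (this is `MoebiusLimitExistsNegative.limit_odd_eq_zero'` /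
  -- `HasPointwiseScalingLimit.eq_zero_of_odd`, kept inline so that this route's files do not import the
  -- `GKSInequalities` / `CriticalUrsellFourSign` cones — cone hygiene of route LogPolarProxy, rev 2).
  have hS : ∀ y ∈ offAxis n, S n y = 0 := fun y hy => by
    have h := (hlim n).tendsto_at (offAxis_subset_nonCoincident n hy)
    have h0 : Tendsto (fun δ => rescaledCorrelator (criticalCorr 3) ρ n δ y) (𝓝[>] 0) (𝓝 0) := by
      refine tendsto_const_nhds.congr fun δ => ?_
      rw [rescaledCorrelator_apply, criticalCorr_three_eq_zero_of_odd hn, mul_zero]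
    exact tendsto_nhds_unique h h0
  exact tendstoLocallyUniformlyOn_of_forall_eq (c := (0 : ℝ))
    (fun N y _ => proxyCorr_eq_zero_of_odd Jr Jt Jp A ρ N hn y) hS

end Summit.CriticalPhenomena.Ising3DConformalLimit.Cruxes.ProxyUniversality.Birth

end
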